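import Literature.NumberTheory.EllipticCurves.PrimeConductorTorsionLValue
import Literature.NumberTheory.EllipticCurves.NeumannSetzerCurvesConductorProofs
import Literature.NumberTheory.EllipticCurves.TwoAdicImageQuadraticTwistProofs
import Literature.NumberTheory.EllipticCurves.BSDSelmerCMPConverseProofs
import Literature.NumberTheory.EllipticCurves.ComplexMultiplication
import Literature.NumberTheory.EllipticCurves.ModularCurve
import Literature.NumberTheory.EllipticCurves.PAdicBSD
import HarnessLib

/-!
# Route `TwoAdicConverse` (rung S3), item 19218 — the Neumann–Setzer curves EXPLICITLY: for every integer
# `u ≡ 3 (mod 4)` with `p = u² + 64` prime, both models `E₀(u)`, `E₁(u)` have `L(E,1) ≠ 0`, `r_an = 0` and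
# `corank_{ℤ₂} Sel_{2^∞}(E/ℚ) = 0` — from PRINT (Mazur 1977 II (18.10) + modularity + Kato 14.3), no binder on
# the curve left

Cell `bsd-2adic`, seat `bsd-2adic-conv-1` (GEN 23). THEOREMS ONLY — no definition, no `sorry`; route-INDEPENDENT
imports (Literature only), so the statements are about the explicit models of `NeumannSetzerCurves.lean` and can be
cited from any route. Sequel of `TwoAdicConversePrimeConductorTwoTorsion.lean` (same seat), whose §5 left the binder
`(W.conductorNorm ℤ).Prime` on the models: that binder is now DISCHARGED by the Literature `Proofs` companion
`NeumannSetzerCurvesConductorProofs.lean` (`conductorNorm_neumannSetzerCurve₀/₁ : N = u² + 64`, B–G 12.5.9 on the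
integer models; `isGloballyMinimal_neumannSetzerCurve₀'/₁'`; `isElliptic_neumannSetzerCurve₀/₁`).

Displayed PRINT binders (as in the whole S3 lane): `hMz` = Mazur 1977 II Thm. (18.10) read on elliptic curves
(`Mazur1977_entireLFunction_one_ne_zero_of_prime_conductor_of_two_torsion`, p649765), `hmod` = modularity
(`nonempty_modularParametrizationData`, the first conjunct of item 19167), `hK` = Kato Cor. 14.3 at `p = 2`.

* `entireLFunction_one_ne_zero_neumannSetzerCurve₁ / ₀` — `L(E₁(u),1) ≠ 0`, `L(E₀(u),1) ≠ 0`;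
* `analyticRank_neumannSetzerCurve₁ / ₀` — `r_an = 0`;
* `selmerCorank_two_neumannSetzerCurve₁ / ₀` — `corank_{ℤ₂} Sel_{2^∞} = 0` (Kato);
* `analyticRank_neumannSetzerCurve₁_of_prime_natAbs` / `₀` — the same keyed by `u` alone (`(u² + 64).natAbs` prime).

HONEST FRAMING: a thin explicit family (conjecturally infinite), inside stratum (β) and inside the `r_an = 0` locus by
PRINT; the S3 cruxes and 19218 stay OPEN; nothing booked (D-0054); BSD is not proved by any of this.
PARTITION (D-0054): none — RANK axis (S3) × X5@2 good-ordinary (β) rows of prime conductor `u² + 64`;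
types-the-object-of. References: [Mazur1977] II Thm. (18.10), III Prop. (7.4) (ii); [SteinWatkins2004] §1, §4.3;
[Kato2004Asterisque] Cor. 14.3; [BCDTJAMS2001] Thm. A.
-/

set_option linter.dupNamespace false
set_option autoImplicit false

noncomputable section

open scoped Classical
open WeierstrassCurve Literature.NumberTheory.EllipticCurves Literature.NumberTheory.EllipticCurves.ModularForms
  Literature.NumberTheory.EllipticCurves.Greenberg1999

namespace Summit.BirchSwinnertonDyer.BirchSwinnertonDyer.Theorems.TwoAdicPrimeConductor

/-! ## §1. A model-free lemma: `L(W,1) ≠ 0` for prime conductor + a `2`-torsion abscissa -/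

/-- `L(W,1) ≠ 0` for an elliptic, globally minimal `W` of prime conductor with a rational point of order `2`
(Mazur II (18.10) via `hMz`; modularity supplies the newform). Route-independent twin of
`entireLFunction_one_ne_zero_of_prime_conductorNorm_of_hasRationalTwoTorsionX`. [cite: Mazur1977, II Thm. (18.10) (p. 139)]
[cite: BCDTJAMS2001, Thm. A] -/
theorem entireLFunction_one_ne_zero_of_prime_conductorNorm'
    (hMz : Mazur1977_entireLFunction_one_ne_zero_of_prime_conductor_of_two_torsion)
    (hmod : nonempty_modularParametrizationData) (W : WeierstrassCurve ℚ) [W.IsElliptic] [W.IsGloballyMinimal]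
    (hN : (W.conductorNorm ℤ).Prime) {x : ℚ} (hx : HasRationalTwoTorsionX W x) : W.entireLFunction 1 ≠ 0 := by
  haveI : NeZero (W.conductorNorm ℤ) := ⟨hN.ne_zero⟩
  obtain ⟨D⟩ := hmod W
  exact hMz W hN ⟨D.f, D.isNewformOf⟩ ((exists_two_torsion_iff_exists_hasRationalTwoTorsionX' W).mpr ⟨x, hx⟩)

/-! ## §2. `E₁(u)`: `y² + xy = x³ − (u+1)/4·x² − x`, `Δ = u² + 64 = p` -/

/-- **`L(E₁(u), 1) ≠ 0`** for `u ≡ 3 (mod 4)`, `p = u² + 64` prime. [cite: Mazur1977, II Thm. (18.10) (p. 139); III §7 (p. 162)]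
[cite: SteinWatkins2004, §1 (PDF p. 3)] -/
theorem entireLFunction_one_ne_zero_neumannSetzerCurve₁
    (hMz : Mazur1977_entireLFunction_one_ne_zero_of_prime_conductor_of_two_torsion)
    (hmod : nonempty_modularParametrizationData) {u : ℤ} {N : ℕ} (hN : N.Prime) (hNu : (N : ℤ) = u ^ 2 + 64)
    (hu : u % 4 = 3) : (neumannSetzerCurve₁ u).entireLFunction 1 ≠ 0 := by
  haveI := isElliptic_neumannSetzerCurve₁ u
  haveI := isGloballyMinimal_neumannSetzerCurve₁' hN hNu hu
  exact entireLFunction_one_ne_zero_of_prime_conductorNorm' hMz hmod _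
    (prime_conductorNorm_neumannSetzerCurve₁ hN hNu hu) (hasRationalTwoTorsionX_neumannSetzerCurve₁ u)

/-- **`ord_{s=1} L(E₁(u), s) = 0`** for `u ≡ 3 (mod 4)`, `p = u² + 64` prime. [cite: Mazur1977, II Thm. (18.10) (p. 139)]
[cite: SteinWatkins2004, §4.3 ("Neumann–Setzer curves have rank 0")] -/
theorem analyticRank_neumannSetzerCurve₁
    (hMz : Mazur1977_entireLFunction_one_ne_zero_of_prime_conductor_of_two_torsion)
    (hmod : nonempty_modularParametrizationData) {u : ℤ} {N : ℕ} (hN : N.Prime) (hNu : (N : ℤ) = u ^ 2 + 64)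
    (hu : u % 4 = 3) : (neumannSetzerCurve₁ u).analyticRank = 0 :=
  Literature.NumberTheory.EllipticCurves.analyticRank_eq_zero_of_entireLFunction_one_ne_zero _
    (entireLFunction_one_ne_zero_neumannSetzerCurve₁ hMz hmod hN hNu hu)

/-- **`corank_{ℤ₂} Sel_{2^∞}(E₁(u)/ℚ) = 0`** for `u ≡ 3 (mod 4)`, `p = u² + 64` prime (Kato 14.3 at `2` on `L ≠ 0`).
[cite: Kato2004Asterisque, Cor. 14.3 (p. 235)] [cite: Mazur1977, II Thm. (18.10) (p. 139)] -/
theorem selmerCorank_two_neumannSetzerCurve₁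
    (hMz : Mazur1977_entireLFunction_one_ne_zero_of_prime_conductor_of_two_torsion)
    (hmod : nonempty_modularParametrizationData)
    (hK : ∀ (V : WeierstrassCurve ℚ) [V.IsElliptic] [V.IsGloballyMinimal], kato_finite_of_L_one_ne_zero V 2)
    {u : ℤ} {N : ℕ} (hN : N.Prime) (hNu : (N : ℤ) = u ^ 2 + 64) (hu : u % 4 = 3) :
    (neumannSetzerCurve₁ u).selmerCorank 2 = 0 := by
  haveI := isElliptic_neumannSetzerCurve₁ u
  haveI := isGloballyMinimal_neumannSetzerCurve₁' hN hNu hu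
  obtain ⟨-, -, hfin⟩ := hK _ (entireLFunction_one_ne_zero_neumannSetzerCurve₁ hMz hmod hN hNu hu)
  exact (finite_selmerGroupPInfty_iff_selmerCorank_eq_zero _ 2).mp hfin

/-! ## §3. `E₀(u)`: `y² + xy = x³ − (u+1)/4·x² + 4x − u`, `Δ = −p²` -/

/-- **`L(E₀(u), 1) ≠ 0`** for `u ≡ 3 (mod 4)`, `p = u² + 64` prime. [cite: Mazur1977, II Thm. (18.10) (p. 139); III §7 (p. 162)]
[cite: SteinWatkins2004, §1 (PDF p. 3)] -/
theorem entireLFunction_one_ne_zero_neumannSetzerCurve₀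
    (hMz : Mazur1977_entireLFunction_one_ne_zero_of_prime_conductor_of_two_torsion)
    (hmod : nonempty_modularParametrizationData) {u : ℤ} {N : ℕ} (hN : N.Prime) (hNu : (N : ℤ) = u ^ 2 + 64)
    (hu : u % 4 = 3) : (neumannSetzerCurve₀ u).entireLFunction 1 ≠ 0 := by
  haveI := isElliptic_neumannSetzerCurve₀ u
  haveI := isGloballyMinimal_neumannSetzerCurve₀' hN hNu hu
  exact entireLFunction_one_ne_zero_of_prime_conductorNorm' hMz hmod _
    (prime_conductorNorm_neumannSetzerCurve₀ hN hNu hu) (hasRationalTwoTorsionX_neumannSetzerCurve₀ u)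

/-- **`ord_{s=1} L(E₀(u), s) = 0`** for `u ≡ 3 (mod 4)`, `p = u² + 64` prime. [cite: Mazur1977, II Thm. (18.10) (p. 139)]
[cite: SteinWatkins2004, §4.3 ("Neumann–Setzer curves have rank 0")] -/
theorem analyticRank_neumannSetzerCurve₀
    (hMz : Mazur1977_entireLFunction_one_ne_zero_of_prime_conductor_of_two_torsion)
    (hmod : nonempty_modularParametrizationData) {u : ℤ} {N : ℕ} (hN : N.Prime) (hNu : (N : ℤ) = u ^ 2 + 64)
    (hu : u % 4 = 3) : (neumannSetzerCurve₀ u).analyticRank = 0 :=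
  Literature.NumberTheory.EllipticCurves.analyticRank_eq_zero_of_entireLFunction_one_ne_zero _
    (entireLFunction_one_ne_zero_neumannSetzerCurve₀ hMz hmod hN hNu hu)

/-- **`corank_{ℤ₂} Sel_{2^∞}(E₀(u)/ℚ) = 0`** for `u ≡ 3 (mod 4)`, `p = u² + 64` prime. [cite: Kato2004Asterisque, Cor. 14.3 (p. 235)]
[cite: Mazur1977, II Thm. (18.10) (p. 139)] -/
theorem selmerCorank_two_neumannSetzerCurve₀
    (hMz : Mazur1977_entireLFunction_one_ne_zero_of_prime_conductor_of_two_torsion)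
    (hmod : nonempty_modularParametrizationData)
    (hK : ∀ (V : WeierstrassCurve ℚ) [V.IsElliptic] [V.IsGloballyMinimal], kato_finite_of_L_one_ne_zero V 2)
    {u : ℤ} {N : ℕ} (hN : N.Prime) (hNu : (N : ℤ) = u ^ 2 + 64) (hu : u % 4 = 3) :
    (neumannSetzerCurve₀ u).selmerCorank 2 = 0 := by
  haveI := isElliptic_neumannSetzerCurve₀ u
  haveI := isGloballyMinimal_neumannSetzerCurve₀' hN hNu hu
  obtain ⟨-, -, hfin⟩ := hK _ (entireLFunction_one_ne_zero_neumannSetzerCurve₀ hMz hmod hN hNu hu)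
  exact (finite_selmerGroupPInfty_iff_selmerCorank_eq_zero _ 2).mp hfin

/-! ## §4. Keyed by `u` alone -/

/-- `u² + 64 > 0`, so its `natAbs` casts back to it. [folklore] -/
private theorem natAbs_sq_add_cast (u : ℤ) : (((u ^ 2 + 64).natAbs : ℕ) : ℤ) = u ^ 2 + 64 :=
  Int.natAbs_of_nonneg (by positivity)

/-- **Both Neumann–Setzer curves have analytic rank `0`, keyed by `u`**: for every `u ≡ 3 (mod 4)` with `u² + 64`
prime, `r_an(E₁(u)) = r_an(E₀(u)) = 0`. [cite: Mazur1977, II Thm. (18.10) (p. 139); III Prop. (7.4) (ii) (p. 163)]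
[cite: SteinWatkins2004, §4.3] -/
theorem analyticRank_neumannSetzerCurves_of_prime_natAbs
    (hMz : Mazur1977_entireLFunction_one_ne_zero_of_prime_conductor_of_two_torsion)
    (hmod : nonempty_modularParametrizationData) {u : ℤ} (hu : u % 4 = 3) (hp : (u ^ 2 + 64).natAbs.Prime) :
    (neumannSetzerCurve₁ u).analyticRank = 0 ∧ (neumannSetzerCurve₀ u).analyticRank = 0 :=
  ⟨analyticRank_neumannSetzerCurve₁ hMz hmod hp (natAbs_sq_add_cast u) hu,
    analyticRank_neumannSetzerCurve₀ hMz hmod hp (natAbs_sq_add_cast u) hu⟩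

/-- **Both Neumann–Setzer curves have `corank_{ℤ₂} Sel_{2^∞} = 0 = r_an`, keyed by `u`** — the S3 leaf's content
(`corank = r ⇒ r_an = r`, `r ≤ 1`) holds for them with both sides `0`.
[cite: Mazur1977, II Thm. (18.10) (p. 139)] [cite: Kato2004Asterisque, Cor. 14.3 (p. 235)] -/
theorem analyticRank_eq_selmerCorank_two_neumannSetzerCurves_of_prime_natAbs
    (hMz : Mazur1977_entireLFunction_one_ne_zero_of_prime_conductor_of_two_torsion)
    (hmod : nonempty_modularParametrizationData)
    (hK : ∀ (V : WeierstrassCurve ℚ) [V.IsElliptic] [V.IsGloballyMinimal], kato_finite_of_L_one_ne_zero V 2)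
    {u : ℤ} (hu : u % 4 = 3) (hp : (u ^ 2 + 64).natAbs.Prime) :
    (neumannSetzerCurve₁ u).analyticRank = (neumannSetzerCurve₁ u).selmerCorank 2 ∧
      (neumannSetzerCurve₀ u).analyticRank = (neumannSetzerCurve₀ u).selmerCorank 2 := by
  rw [analyticRank_neumannSetzerCurve₁ hMz hmod hp (natAbs_sq_add_cast u) hu,
    analyticRank_neumannSetzerCurve₀ hMz hmod hp (natAbs_sq_add_cast u) hu,
    selmerCorank_two_neumannSetzerCurve₁ hMz hmod hK hp (natAbs_sq_add_cast u) hu,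
    selmerCorank_two_neumannSetzerCurve₀ hMz hmod hK hp (natAbs_sq_add_cast u) hu]
  exact ⟨rfl, rfl⟩

end Summit.BirchSwinnertonDyer.BirchSwinnertonDyer.Theorems.TwoAdicPrimeConductor

end
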